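import Summits.QuantumFields.YangMills.Theorems.UnitScaleTiltProp7ChartDatumSplit
import Summits.QuantumFields.YangMills.Theorems.UnitScaleTiltProp7SymAvgTwSymDefs
import Summits.QuantumFields.YangMills.Theorems.UnitScaleTiltProp7SPrintDefsS
import HarnessLib

/-!
# Route `UnitScaleTilt`, crux K1 child «MinimiserStabilityRegPr» (stmt-QuantumFields-19200), skeleton v10, stub `stub_existenceMinimalOrbit` (EX), route (α) — **(CH-KNIT v2ˢ) FILE Cˢ:
# THE DATUM-ROW SPLIT AT SCALE, IN THE LETTERS OF RECORD** — the (α-S)∕№12 twin of ✓`Prop7ChartDatumSplit` §5 (`datum_of_split_eta`, `hXtw_of_split_eta`): print's averaging operator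
# is now `Q(U₀) = η·(QTwS U₀ ∘ ι)` (`QTwS := fderiv (logChartTwS U₀) 0`, symmetric centre-anchored frames, ★★OWNER RULING g26-№12), the chart remainder is `Dfix (CmapTwS U₀) H C₂`, and
# the E–L clause quantifies over the `NormS`-normalised representatives (RULING g26-№19).  The (115) ↔ torus dictionary `ι` and PIN-B (`norm_jetRead_le`, `jetRead_add`,
# `mlog_datum_eq`) are frame-free and IMPORTED from ✓`Prop7ChartDatumSplit`; the algebra is the same two `map_add`∕`map_smul` lines

Cell `ym3-torus`, width seat `ym-ust-19200-w2` (gen 3; EX KNIT RULER).  THEOREMS ONLY (0 `def`, 0 `sorry`).  Linear-algebra bookkeeping: nothing here closes the stub; `--supports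
stmt-QuantumFields-19200 --as helper`, count-neutral.  YM₃ on T³ is a ladder rung (R3), not the Clay problem; nothing here claims the stub, the crux, d = 4 or the mass gap.

THE PRINT.  [Balaban1985Variational] p. 293: «Let us define A′ = A₁ + H₁B, (103) … the conditions (102) can be written as Q A₁ = 0, R D* A₁ = 0»; p. 294 (111)–(112); p. 297 (129):
«H₁B = G₁Q*(QG₁Q*)⁻¹B», so «QH₁B = B»; p. 281 (20) and [Balaban1985RegularSpaces] (1.37) p. 82; [Balaban1985BackgroundPropagators] (3.14) p. 393 «(1∕η_j)Q_j(U, ηA) = Q_j(U)A +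
C_j(U, A)» — the `η`-scaling of the chart parameter.

WHAT IS PROVED (sorry-free, no definition).  ★ **`datum_of_split_etaS`** — (102)-twS `QTwS U₀ (ι(𝔊f)) = 0` and (129)-twS `QTwS U₀ (ι(H₁B)) = η⁻¹·B` give, for every solution `A₁` of
(111), `QTwS U₀ (iη·(ι A₁ + ι(H₁ Bsym))) = log(V·Ū₀⁻¹)`.  ★★ **`hXtw_of_split_etaS`** — the (CH5EL-twˢ) display `hXtw` of ✓`Prop7ChartPiecesTwS.hChart_of_piecesTwS` (∃ A′ X …) FROM the
refined display `hXtw′` (∃ X only: Hermitian-traceless, `A′ − H·Dfix(CmapTwS U₀)(A′) = iX` at `A′ := iη·(ι A₁ + ι(H₁ Bsym))`, (19)-size, (21), E–L at the `NormS`-representatives), the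
two rows, and the radius window `η(ε₄ + ρ) ≤ ε`.  HONEST SCOPE: bookkeeping; (102)-twS∕(129)-twS are rows about the opaque letters `𝔊(U₀)`, `H₁(U₀)` against `QTwS`.

References: T. Bałaban, CMP 102 (1985) 277–309 [Balaban1985Variational] ((19)–(21) p.281, (43) p.285, (102)–(103) p.293, (111)–(112) p.294, (115) p.294, (129) p.297); CMP 99 (1985)
75–102 [Balaban1985RegularSpaces] ((1.37) p.82); CMP 99 (1985) 389–434 [Balaban1985BackgroundPropagators] ((3.14) p.393, (3.147)–(3.153) pp.425–426).
-/

set_option autoImplicit false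

noncomputable section

open scoped Matrix.Norms.L2Operator

namespace Summit.QuantumFields.YangMills.Theorems.Prop7ChartDatumSplitS

open NormedSpace
open Literature.MathematicalPhysics.QuantumFieldTheory.Balaban1983to89
open Literature.MathematicalPhysics.QuantumFieldTheory.Balaban1983to89.T3ContinuumYM3Torus
open Literature.MathematicalPhysics.QuantumFieldTheory.Balaban1983to89.T3UnitLawDensityEML (ℰp)
open Literature.MathematicalPhysics.QuantumFieldTheory.Balaban1983to89.T3TiltDescent (descendTo)
open Literature.MathematicalPhysics.QuantumFieldTheory.Balaban1983to89.T3ConstrainedMinimiser (fibre)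
open Literature.MathematicalPhysics.QuantumFieldTheory.Balaban1983to89.T3SectALandauChart (emb15)
open B9SectCLatticeCarrier (Bond)
open B10Eq27TorusAxialLog (unitsField toUField val_unitsField)
open B11Eq115Space (NegSize Space115 JetSup levWeight)
open B11Eq111FrakG (nabla115)
open B11Eq98CurrentSlot (Jcur)
open B11Prop3Model (Dfix)
open MatrixLog (mlog)
open Summit.QuantumFields.YangMills.Theorems.Prop7TPrint (nMax19 expHermField)
open Summit.QuantumFields.YangMills.Theorems.Prop7SPrint (IsLandauPrint NormS)
open Summit.QuantumFields.YangMills.Theorems.Prop7SectET3Transport (periodsT3 bgOfCfg bondEquiv levWeight_const_eq_one)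
open Summit.QuantumFields.YangMills.Theorems.Prop7SymAvgTwSym (QTwS CmapTwS)
open Summit.QuantumFields.YangMills.Theorems.Prop7ChartDatumSplit (norm_jetRead_le jetRead_add mlog_datum_eq)

variable (F : T3Family) {n K : ℕ} (h : n ≤ K)

/-! ## §5 THE DICTIONARY AT THE RIGHT SCALE (OF RECORD): chart parameters are `η`-type, (115)-fields are `A`-type

Print measures (115)-fields `A₁`, `H₁B` in the `A`-scale of `U = e^{iηA}` and the chart parameter of the twisted chart in the exponent scale `ηA` ([Balaban1985Variational] (19) p.281,
(112) p.294 «U₁ = exp iη(A′₁ − HD(A′₁))»; [Balaban1985BackgroundPropagators] (3.14) «(1∕η_j)Q_j(U, ηA) = Q_j(U)A + C_j(U, A)», `η_k = Lᵏη = 1` at the T³ member): the torus chart parameter of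
print's `A′ = A₁ + H₁B` is `iη·ι(A₁ + H₁B)`, and print's NORMALISED averaging operator is `Q(U₀) = η·(QTwS U₀ ∘ ι)`, so «`QH₁B = B`» reads `QTw U₀ (ι(H₁B)) = η⁻¹B`.  §3–§4 above are the
`η = 1` normalisation of the same algebra (valid, but not the rows a supplier of print's `H₁(U₀)` meets when `K > n`); THIS section is the one the knit consumes. -/

section SplitEta

open Literature.MathematicalPhysics.QuantumFieldTheory.Balaban1983to89.T3SectALandauChart (eta eta_pos)

variable [Fact (0 < (F.L : ℝ))] [Fact (0 < ((F.L : ℝ)⁻¹) ^ (K - n))]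
  {V : GaugeField (F.P n) 0 (Matrix.specialUnitaryGroup (Fin 2) ℂ)} {U₀ : GaugeField (F.P K) 0 (Matrix.specialUnitaryGroup (Fin 2) ℂ)}
  {𝒢 : NegSize (F.L : ℝ) (((F.L : ℝ)⁻¹) ^ (K - n)) (fun _ : Bond 3 (periodsT3 F K) => K - n) 3 (Matrix (Fin 2) (Fin 2) ℂ) →L[ℂ]
        Space115 (F.L : ℝ) (((F.L : ℝ)⁻¹) ^ (K - n)) (fun _ : Bond 3 (periodsT3 F K) => K - n) (fun _ : Bond 3 (periodsT3 F K) × Fin 3 => K - n)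
          (nabla115 (((F.L : ℝ)⁻¹) ^ (K - n)) (bgOfCfg F K U₀))}
  {W : Space115 (F.L : ℝ) (((F.L : ℝ)⁻¹) ^ (K - n)) (fun _ : Bond 3 (periodsT3 F K) => K - n) (fun _ : Bond 3 (periodsT3 F K) × Fin 3 => K - n)
          (nabla115 (((F.L : ℝ)⁻¹) ^ (K - n)) (bgOfCfg F K U₀)) →
        NegSize (F.L : ℝ) (((F.L : ℝ)⁻¹) ^ (K - n)) (fun _ : Bond 3 (periodsT3 F K) => K - n) 3 (Matrix (Fin 2) (Fin 2) ℂ)}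
  {H₁ : (PBond (F.P n) 0 → Matrix (Fin 2) (Fin 2) ℂ) →L[ℂ]
        Space115 (F.L : ℝ) (((F.L : ℝ)⁻¹) ^ (K - n)) (fun _ : Bond 3 (periodsT3 F K) => K - n) (fun _ : Bond 3 (periodsT3 F K) × Fin 3 => K - n)
          (nabla115 (((F.L : ℝ)⁻¹) ^ (K - n)) (bgOfCfg F K U₀))}
  {H : (PBond (F.P n) 0 → Matrix (Fin 2) (Fin 2) ℂ) →ₗ[ℂ] (PBond (F.P K) 0 → Matrix (Fin 2) (Fin 2) ℂ)}

/-- ★ **THE DATUM ROW FROM (102) AND (129), AT SCALE**: with print's normalised `Q(U₀) = η·(QTwS U₀ ∘ ι)` — (102)-tw «`Q𝔊 = 0`»: `QTw U₀ (ι(𝔊f)) = 0`; (129) «`QH₁B = B`»: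
`QTw U₀ (ι(H₁B)) = η⁻¹·B` — every solution `A₁` of (111) (so `A₁ ∈ range 𝔊`) gives the chart parameter `A′ := iη·(ι A₁ + ι(H₁ Bsym))` of print's `A′ = A₁ + H₁B` ((103), (112)) the
twisted linear average `Q(U₀)A′ = i·Bsym = log(V·Ū₀⁻¹)` ((20)∕(1.37)). [cite: Balaban1985Variational, (102)–(103) p.293, (111)–(112) p.294, (129) p.297, (20) p.281; Balaban1985BackgroundPropagators, (3.14) p.393] -/
theorem datum_of_split_etaS
    (h102 : ∀ f : NegSize (F.L : ℝ) (((F.L : ℝ)⁻¹) ^ (K - n)) (fun _ : Bond 3 (periodsT3 F K) => K - n) 3 (Matrix (Fin 2) (Fin 2) ℂ),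
      QTwS F n K h U₀ (fun b : PBond (F.P K) 0 => JetSup.equiv _ _ _ (𝒢 f) (bondEquiv F K b)) = 0)
    (h129 : ∀ B : PBond (F.P n) 0 → Matrix (Fin 2) (Fin 2) ℂ,
      QTwS F n K h U₀ (fun b : PBond (F.P K) 0 => JetSup.equiv _ _ _ (H₁ B) (bondEquiv F K b)) = fun c => (((eta F n K : ℝ) : ℂ))⁻¹ • B c)
    (A₁ : Space115 (F.L : ℝ) (((F.L : ℝ)⁻¹) ^ (K - n)) (fun _ : Bond 3 (periodsT3 F K) => K - n) (fun _ : Bond 3 (periodsT3 F K) × Fin 3 => K - n)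
      (nabla115 (((F.L : ℝ)⁻¹) ^ (K - n)) (bgOfCfg F K U₀)))
    (h111 : A₁ + 𝒢 (Jcur (bgOfCfg F K U₀)) + 𝒢 (W (A₁ + H₁ (fun c : PBond (F.P n) 0 =>
        (-Complex.I) • mlog (((V c : Matrix.specialUnitaryGroup (Fin 2) ℂ) : Matrix (Fin 2) (Fin 2) ℂ)
          * star ((descendTo F ℰp n K h U₀ c : Matrix.specialUnitaryGroup (Fin 2) ℂ) : Matrix (Fin 2) (Fin 2) ℂ))))) = 0) :
    QTwS F n K h U₀ ((((eta F n K : ℝ) : ℂ) * Complex.I) • ((fun b : PBond (F.P K) 0 => JetSup.equiv _ _ _ A₁ (bondEquiv F K b))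
              + (fun b : PBond (F.P K) 0 => JetSup.equiv _ _ _ (H₁ (fun c : PBond (F.P n) 0 =>
        (-Complex.I) • mlog (((V c : Matrix.specialUnitaryGroup (Fin 2) ℂ) : Matrix (Fin 2) (Fin 2) ℂ)
          * star ((descendTo F ℰp n K h U₀ c : Matrix.specialUnitaryGroup (Fin 2) ℂ) : Matrix (Fin 2) (Fin 2) ℂ)))) (bondEquiv F K b))))
      = (fun c => mlog (((unitsField (toUField V) c * (unitsField (toUField (descendTo F ℰp n K h U₀)) c)⁻¹ :
              (Matrix (Fin 2) (Fin 2) ℂ)ˣ) : Matrix (Fin 2) (Fin 2) ℂ))) := by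
  have hη : (((eta F n K : ℝ) : ℂ)) ≠ 0 := by exact_mod_cast (eta_pos F n K).ne'
  have hA₁ : A₁ = 𝒢 (-(Jcur (bgOfCfg F K U₀) + W (A₁ + H₁ (fun c : PBond (F.P n) 0 =>
        (-Complex.I) • mlog (((V c : Matrix.specialUnitaryGroup (Fin 2) ℂ) : Matrix (Fin 2) (Fin 2) ℂ)
          * star ((descendTo F ℰp n K h U₀ c : Matrix.specialUnitaryGroup (Fin 2) ℂ) : Matrix (Fin 2) (Fin 2) ℂ)))))) := by
    rw [map_neg, map_add]
    exact eq_neg_of_add_eq_zero_left (by rw [← add_assoc]; exact h111)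
  have hsc : (((eta F n K : ℝ) : ℂ)) * Complex.I * (((eta F n K : ℝ) : ℂ))⁻¹ = Complex.I := by
    rw [mul_comm _ Complex.I, mul_assoc, mul_inv_cancel₀ hη, mul_one]
  rw [map_smul, map_add, hA₁, h102, zero_add, h129]
  funext c
  rw [Pi.smul_apply, smul_smul, hsc]
  exact mlog_datum_eq F h V U₀ c

/-- ★★ **THE (CH5EL-twˢ) DISPLAY `hXtw` OF ✓`Prop7ChartPiecesTwS.hChart_of_piecesTwS` FROM THE REFINED DISPLAY `hXtw′` AND THE ROWS (102)-tw ∕ (129)-tw, AT SCALE**: chart parameter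
`A′ := iη·(ι A₁ + ι(H₁ Bsym))` (print's (103) + (112)); datum equation by `datum_of_split_eta`; radius `‖A′‖ = η·‖ι A₁ + ι(H₁B)‖ < η(ε₄ + ρ) ≤ ε` (§1; print's «|A′| < ε₃» at the top level,
[Balaban1985Variational] (43) p.285, in the exponent scale); remaining conjuncts — `X` Hermitian-traceless with `A′ − H(DA′) = iX`, (19)-size `≤ M(‖A₁‖ + ‖H₁B‖)`, (21), E–L — are the
refined display `hXtw′` (XL). [cite: Balaban1985Variational, (43) p.285, (103) p.293, (112) p.294, Prop. 5 p.294, (123)–(140) pp.296–299, (19)–(21) p.281] -/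
theorem hXtw_of_split_etaS {ε₄ M C₂ ε ρ : ℝ}
    (h102 : ∀ f : NegSize (F.L : ℝ) (((F.L : ℝ)⁻¹) ^ (K - n)) (fun _ : Bond 3 (periodsT3 F K) => K - n) 3 (Matrix (Fin 2) (Fin 2) ℂ),
      QTwS F n K h U₀ (fun b : PBond (F.P K) 0 => JetSup.equiv _ _ _ (𝒢 f) (bondEquiv F K b)) = 0)
    (h129 : ∀ B : PBond (F.P n) 0 → Matrix (Fin 2) (Fin 2) ℂ,
      QTwS F n K h U₀ (fun b : PBond (F.P K) 0 => JetSup.equiv _ _ _ (H₁ B) (bondEquiv F K b)) = fun c => (((eta F n K : ℝ) : ℂ))⁻¹ • B c)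
    (hρ : ‖H₁ (fun c : PBond (F.P n) 0 =>
        (-Complex.I) • mlog (((V c : Matrix.specialUnitaryGroup (Fin 2) ℂ) : Matrix (Fin 2) (Fin 2) ℂ)
          * star ((descendTo F ℰp n K h U₀ c : Matrix.specialUnitaryGroup (Fin 2) ℂ) : Matrix (Fin 2) (Fin 2) ℂ)))‖ ≤ ρ)
    (hε : eta F n K * (ε₄ + ρ) ≤ ε)
    -- the refined display: (112) ∘ Prop. 5 ∘ (123)–(140) ∘ E–L at `A′ := iη·(ι A₁ + ι(H₁ Bsym))`
    (hXtw' : ∀ A₁ : Space115 (F.L : ℝ) (((F.L : ℝ)⁻¹) ^ (K - n)) (fun _ : Bond 3 (periodsT3 F K) => K - n) (fun _ : Bond 3 (periodsT3 F K) × Fin 3 => K - n)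
            (nabla115 (((F.L : ℝ)⁻¹) ^ (K - n)) (bgOfCfg F K U₀)),
      ‖A₁‖ < ε₄ → A₁ + 𝒢 (Jcur (bgOfCfg F K U₀)) + 𝒢 (W (A₁ + H₁ (fun c : PBond (F.P n) 0 =>
        (-Complex.I) • mlog (((V c : Matrix.specialUnitaryGroup (Fin 2) ℂ) : Matrix (Fin 2) (Fin 2) ℂ)
          * star ((descendTo F ℰp n K h U₀ c : Matrix.specialUnitaryGroup (Fin 2) ℂ) : Matrix (Fin 2) (Fin 2) ℂ))))) = 0 →
        ∃ X : PBond (F.P K) 0 → Matrix (Fin 2) (Fin 2) ℂ,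
          (∀ b : PBond (F.P K) 0, (X b).IsHermitian ∧ Matrix.trace (X b) = 0) ∧
          (((eta F n K : ℝ) : ℂ) * Complex.I) • ((fun b : PBond (F.P K) 0 => JetSup.equiv _ _ _ A₁ (bondEquiv F K b))
              + (fun b : PBond (F.P K) 0 => JetSup.equiv _ _ _ (H₁ (fun c : PBond (F.P n) 0 =>
        (-Complex.I) • mlog (((V c : Matrix.specialUnitaryGroup (Fin 2) ℂ) : Matrix (Fin 2) (Fin 2) ℂ)
          * star ((descendTo F ℰp n K h U₀ c : Matrix.specialUnitaryGroup (Fin 2) ℂ) : Matrix (Fin 2) (Fin 2) ℂ)))) (bondEquiv F K b)))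
            - H (Dfix (CmapTwS F n K h U₀) H C₂
              ((((eta F n K : ℝ) : ℂ) * Complex.I) • ((fun b : PBond (F.P K) 0 => JetSup.equiv _ _ _ A₁ (bondEquiv F K b))
              + (fun b : PBond (F.P K) 0 => JetSup.equiv _ _ _ (H₁ (fun c : PBond (F.P n) 0 =>
        (-Complex.I) • mlog (((V c : Matrix.specialUnitaryGroup (Fin 2) ℂ) : Matrix (Fin 2) (Fin 2) ℂ)
          * star ((descendTo F ℰp n K h U₀ c : Matrix.specialUnitaryGroup (Fin 2) ℂ) : Matrix (Fin 2) (Fin 2) ℂ)))) (bondEquiv F K b)))))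
            = (fun b => Complex.I • X b) ∧
          nMax19 F n K U₀ X ≤ M * (‖A₁‖ + ‖H₁ (fun c : PBond (F.P n) 0 =>
        (-Complex.I) • mlog (((V c : Matrix.specialUnitaryGroup (Fin 2) ℂ) : Matrix (Fin 2) (Fin 2) ℂ)
          * star ((descendTo F ℰp n K h U₀ c : Matrix.specialUnitaryGroup (Fin 2) ℂ) : Matrix (Fin 2) (Fin 2) ℂ)))‖) ∧
          IsLandauPrint F n K U₀ X ∧
          (∀ u : GaugeTransf (F.P K) 0 (Matrix.specialUnitaryGroup (Fin 2) ℂ), NormS F n K h U₀ X (expHermField X) u →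
            GaugeField.gaugeAct u (emb15 U₀ (expHermField X)) ∈ fibre F ℰp n K h V →
            ∀ γ : ℝ → GaugeField (F.P K) 0 (Matrix.specialUnitaryGroup (Fin 2) ℂ), γ 0 = GaugeField.gaugeAct u (emb15 U₀ (expHermField X)) →
              (∀ t, γ t ∈ fibre F ℰp n K h V) →
              (∀ b, DifferentiableAt ℝ (fun t => ((γ t b : Matrix.specialUnitaryGroup (Fin 2) ℂ) : Matrix (Fin 2) (Fin 2) ℂ)) 0) →
                deriv (fun t => wilsonAction4 (γ t)) 0 = 0)) :
    ∀ A₁ : Space115 (F.L : ℝ) (((F.L : ℝ)⁻¹) ^ (K - n)) (fun _ : Bond 3 (periodsT3 F K) => K - n) (fun _ : Bond 3 (periodsT3 F K) × Fin 3 => K - n)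
          (nabla115 (((F.L : ℝ)⁻¹) ^ (K - n)) (bgOfCfg F K U₀)),
      ‖A₁‖ < ε₄ → A₁ + 𝒢 (Jcur (bgOfCfg F K U₀)) + 𝒢 (W (A₁ + H₁ (fun c : PBond (F.P n) 0 =>
        (-Complex.I) • mlog (((V c : Matrix.specialUnitaryGroup (Fin 2) ℂ) : Matrix (Fin 2) (Fin 2) ℂ)
          * star ((descendTo F ℰp n K h U₀ c : Matrix.specialUnitaryGroup (Fin 2) ℂ) : Matrix (Fin 2) (Fin 2) ℂ))))) = 0 →
        ∃ (A' : PBond (F.P K) 0 → Matrix (Fin 2) (Fin 2) ℂ) (X : PBond (F.P K) 0 → Matrix (Fin 2) (Fin 2) ℂ),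
          ‖A'‖ < ε ∧
          QTwS F n K h U₀ A' = (fun c => mlog (((unitsField (toUField V) c * (unitsField (toUField (descendTo F ℰp n K h U₀)) c)⁻¹ :
              (Matrix (Fin 2) (Fin 2) ℂ)ˣ) : Matrix (Fin 2) (Fin 2) ℂ))) ∧
          (∀ b : PBond (F.P K) 0, (X b).IsHermitian ∧ Matrix.trace (X b) = 0) ∧
          A' - H (Dfix (CmapTwS F n K h U₀) H C₂ A') = (fun b => Complex.I • X b) ∧
          nMax19 F n K U₀ X ≤ M * (‖A₁‖ + ‖H₁ (fun c : PBond (F.P n) 0 =>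
        (-Complex.I) • mlog (((V c : Matrix.specialUnitaryGroup (Fin 2) ℂ) : Matrix (Fin 2) (Fin 2) ℂ)
          * star ((descendTo F ℰp n K h U₀ c : Matrix.specialUnitaryGroup (Fin 2) ℂ) : Matrix (Fin 2) (Fin 2) ℂ)))‖) ∧ IsLandauPrint F n K U₀ X ∧
          (∀ u : GaugeTransf (F.P K) 0 (Matrix.specialUnitaryGroup (Fin 2) ℂ), NormS F n K h U₀ X (expHermField X) u →
            GaugeField.gaugeAct u (emb15 U₀ (expHermField X)) ∈ fibre F ℰp n K h V →
            ∀ γ : ℝ → GaugeField (F.P K) 0 (Matrix.specialUnitaryGroup (Fin 2) ℂ), γ 0 = GaugeField.gaugeAct u (emb15 U₀ (expHermField X)) →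
              (∀ t, γ t ∈ fibre F ℰp n K h V) →
              (∀ b, DifferentiableAt ℝ (fun t => ((γ t b : Matrix.specialUnitaryGroup (Fin 2) ℂ) : Matrix (Fin 2) (Fin 2) ℂ)) 0) →
                deriv (fun t => wilsonAction4 (γ t)) 0 = 0) := by
  intro A₁ hA₁ h111
  obtain ⟨X, hX, hAX, hsize, h21, hEL⟩ := hXtw' A₁ hA₁ h111
  refine ⟨_, X, ?_, datum_of_split_etaS F h h102 h129 A₁ h111, hX, hAX, hsize, h21, hEL⟩
  -- `‖A′‖ = η·‖ι A₁ + ι(H₁B)‖ ≤ η(‖A₁‖₍₁₁₅₎ + ‖H₁B‖₍₁₁₅₎) < η(ε₄ + ρ) ≤ ε`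
  have hη0 : 0 < eta F n K := eta_pos F n K
  have hnI : ‖(((eta F n K : ℝ) : ℂ)) * Complex.I‖ = eta F n K := by
    rw [norm_mul, Complex.norm_I, mul_one, Complex.norm_real, Real.norm_of_nonneg hη0.le]
  rw [norm_smul, hnI]
  calc eta F n K * ‖(fun b : PBond (F.P K) 0 => JetSup.equiv _ _ _ A₁ (bondEquiv F K b))
          + (fun b : PBond (F.P K) 0 => JetSup.equiv _ _ _ (H₁ (fun c : PBond (F.P n) 0 =>
        (-Complex.I) • mlog (((V c : Matrix.specialUnitaryGroup (Fin 2) ℂ) : Matrix (Fin 2) (Fin 2) ℂ)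
          * star ((descendTo F ℰp n K h U₀ c : Matrix.specialUnitaryGroup (Fin 2) ℂ) : Matrix (Fin 2) (Fin 2) ℂ)))) (bondEquiv F K b))‖
      ≤ eta F n K * (‖A₁‖ + ‖H₁ (fun c : PBond (F.P n) 0 =>
        (-Complex.I) • mlog (((V c : Matrix.specialUnitaryGroup (Fin 2) ℂ) : Matrix (Fin 2) (Fin 2) ℂ)
          * star ((descendTo F ℰp n K h U₀ c : Matrix.specialUnitaryGroup (Fin 2) ℂ) : Matrix (Fin 2) (Fin 2) ℂ)))‖) := by
        refine mul_le_mul_of_nonneg_left ((norm_add_le _ _).trans (add_le_add (norm_jetRead_le F _) (norm_jetRead_le F _))) hη0.le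
    _ < eta F n K * (ε₄ + ρ) := mul_lt_mul_of_pos_left (add_lt_add_of_lt_of_le hA₁ hρ) hη0
    _ ≤ ε := hε

end SplitEta

end Summit.QuantumFields.YangMills.Theorems.Prop7ChartDatumSplitS

end
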